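/-
Copyright (c) 2026 the pub-hodgecm-mathlib formalisation cell (harness21).  Prover seat hodgecm-mathlib-LH4-p15 (g0), req620 Track A «(D-RAM) FOUR-FRAME» squad
((β₂) road (R-36) «PURE-CELL LEDGER»; (AX-sh-C) toolkit = lane-C (RamM) twin of ★ p862503 `F0P3cDyRamAxisLetterToolkit` §3–§4, dealt by LH4-p12 (g8) 22:39:53Z «YOURS — the lane-C
twin»; letters per LH4-p12's memo `AXIS-HDICH-LANEC-SCOPING.v1` (2c5dc5b5) and `beta2CellsCFrame.letter.v1` (931c87fe)), 2026-09-04.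
-/
import Summits.HodgeConjecture.HodgeConjecture.Theorems.F0P3cDyRamAxisLetterToolkit   -- ★ p862503 (this seat): `v_sub_map_le_mul_of_datum`, `coords_fixed`, `v_coords_le`; brings ★ `WildQuadraticDatumTrace` (`exists_v_eq_exp_of_map_eq_neg`, `v_varpi_pow`), ★ DEFS `IsOrd`
import HarnessLib

/-!
# Crux `H413`, line LH4 «(D-RAM) FOUR-FRAME» — STAGE-1b, row (2), the (β₂) road (R-36), row (AX-sh-C) TOOLKIT: the sizes of the lane-C (RamM) line model — `jE` squares
# valuations, `|α − ρα| = exp(−dρ)`, the `κ` of a unimodular axis line, and the lower token with the SKEW PARITY of `ρ`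

Cell `hodgecm-mathlib` (D-0151), FLOOR 0, crux item H413 = `stmt-HodgeConjecture-24833`, route of record `HCCMUnconditional`; squad F0∕P3c∕LH4; lane
`--supports stmt-HodgeConjecture-24833 --as helper` (count-neutral; pays NO tier-0 row).  THEOREMS ONLY (no `def`, no instance, no notation, no `sorry`, default heartbeats);
★-only imports; states NO law.  DATUM-FREE over the lane-C line-model letters of `beta2CellsCFrame.letter.v1` (M-normalised valuation, `|jE a| = |a|²`, `α − ρα = ϖM − ρϖM`, the
relative datum `IsRamifiedQuadraticDatum ρ ϖM dρ tρ`, ★ DEFS `IsOrd`).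

WHY (LH4-p12 (g8) 22:39:53Z + memo 2c5dc5b5; consumer = ★-file `F0P3cDyRamAxisLetterEstimatesRamM`).  The lane A∕B toolkit ★ p862503 assumed `|jE a| = |a|` and `|α − ρα| = 1`
in exactly two places — the `κ`-facts of §3 and the token readings of §4; these are their lane-C forms:
* `v_map_varpi_pow_sq` (`|jE ϖ^n| = exp(−2n)`), `v_map_le_one_iff_sq`; `v_sub_map_le_mul_of_fixed_sq` — the skew gain of `σ` through `jE`:
  `|X − ΘX| ≤ |X|·exp(−2(d − 1))` for `ρ`-fixed `X`.
* `v_trace_mul_alpha_eq'` — `|Tr_ρ(κα)| = |κ|·|α − ρα|` when `|κ + ρκ|·|α| ≤ 1 < |κ|·|α − ρα|`; `v_trace_mul_le_one_of_isOrd'` — `Tr_ρ(κ·𝒪_j)` is integral when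
  `|κ|·|cc|·|α − ρα| ≤ 1` (unimodularity; LH4-p12's `htr`, PROVED rather than assumed).
* `v_sub_map_eq_of_tokens` — level token + NOT level `ℓ + 1` + `|w| ≤ exp(−2k′)` ⇒ `|w − ρw| = exp(−(2ℓ + 2j + dρ))` EXACTLY (skew parity ★ `exists_v_eq_exp_of_map_eq_neg` for `ρ`)
  and `k′ ≤ j + ℓ` (skew gain ★ `v_sub_map_le_mul_of_datum` for the relative datum).
HONEST LABEL.  Count-neutral line-model algebra; nothing printed is asserted; no census law is stated; `HC_CM` is proved only modulo the 7 printed citations (2 remaining named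
inputs: hLiu418 = `stmt-HodgeConjecture-24832`, h413 = `stmt-HodgeConjecture-24833`) until rung 0 closes.
## References
* [Serre1979] J.-P. Serre, *Local Fields*, GTM 67 (1979): Ch. III §6 Prop. 12–13 (orders; different and skew parity of a ramified quadratic extension).
* [Jacobowitz1962] R. Jacobowitz, *Hermitian forms over local fields*, Amer. J. Math. 84 (1962): §4 (unimodular hermitian lines over an order).
* [Kottwitz1986BaseChangeUnits] R. E. Kottwitz, *Base change for unit elements of Hecke algebras*, Compositio Math. 60 (1986): §1 pp. 240–241.
-/

set_option autoImplicit false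

noncomputable section

namespace Summit.HodgeConjecture.HodgeConjecture.Cruxes.H413.F0P3cDyRamAxisLetterToolkitRamM

open scoped Valued WithZero
open WithZero
open Literature.NumberTheory.Automorphic.UnitaryThreeFourFrame (IsRamifiedQuadraticDatum)
open Literature.NumberTheory.LocalFields.WildQuadraticDatum
open Summit.HodgeConjecture.HodgeConjecture.Cruxes.H413.F0P3cDyRamToricCensusDefs
open Summit.HodgeConjecture.HodgeConjecture.Cruxes.H413.F0P3cDyRamAxisLetterToolkit


variable {E M : Type} [Field E] [Valued E ℤᵐ⁰] [Field M] [Valued M ℤᵐ⁰] {σ : E →+* E} {ϖ : E} {d t : ℕ} {ρ Θ : M →+* M} {α ϖM : M} {dρ tρ : ℕ}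

/-! ## §1 Lane-C sizes: `jE` squares valuations, `|α − ρα| = exp(−dρ)`, the `κ` of a unimodular line, the lower token with skew parity -/

/-- `|jE ϖ ^ n| = exp(−2n)` when `|jE a| = |a|²` and `|ϖ| = exp(−1)`. [cite: Serre1979, Ch. III §6 Prop. 12] -/
theorem v_map_varpi_pow_sq {ϖ : E} (hϖ : Valued.v ϖ = exp (-1 : ℤ)) (jE : E →+* M) (hjsq : ∀ a, Valued.v (jE a) = Valued.v a ^ 2) (n : ℕ) :
    Valued.v (jE ϖ ^ n) = exp (-(2 * (n : ℤ))) := by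
  rw [map_pow, hjsq, hϖ, ← pow_mul, ← exp_nsmul, nsmul_eq_mul]; push_cast; ring

/-- `|jE c| ≤ 1 ↔ |c| ≤ 1` when `|jE a| = |a|²`. [cite: Serre1979, Ch. III §6 Prop. 12] -/
theorem v_map_le_one_iff_sq (jE : E →+* M) (hjsq : ∀ a, Valued.v (jE a) = Valued.v a ^ 2) (c : E) : Valued.v (jE c) ≤ 1 ↔ Valued.v c ≤ 1 := by
  rw [hjsq, pow_le_one_iff (by norm_num : (2 : ℕ) ≠ 0)]

/-- **THE SKEW GAIN OF `E` THROUGH A SQUARING EMBEDDING**: for `ρ`-fixed `X = jE x`, `|X − ΘX| = |x − σx|² ≤ |X|·exp(−2(d − 1))` (★ toolkit `v_sub_map_le_mul_of_datum`).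
[cite: Serre1979, Ch. III §6 Prop. 13] -/
theorem v_sub_map_le_mul_of_fixed_sq (hD : IsRamifiedQuadraticDatum σ ϖ d t) (jE : E →+* M) (hjsq : ∀ a, Valued.v (jE a) = Valued.v a ^ 2)
    (hjfix : ∀ z, ρ z = z ↔ ∃ c, jE c = z) (hΘj : ∀ x, Θ (jE x) = jE (σ x)) {X : M} (hX : ρ X = X) :
    Valued.v (X - Θ X) ≤ Valued.v X * exp (-(2 * ((d : ℤ) - 1))) := by
  have hϖ := hD.2.2.1
  have h1d := hD.2.2.2.2.2.1
  obtain ⟨x, rfl⟩ := (hjfix X).1 hX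
  rw [hΘj, ← map_sub, hjsq, hjsq]
  have h := v_sub_map_le_mul_of_datum hD x
  have hpow : Valued.v ϖ ^ (d - 1) = exp (-((d : ℤ) - 1)) := by
    rw [v_varpi_pow hϖ]; congr 1; omega
  rw [hpow] at h
  calc Valued.v (x - σ x) ^ 2 ≤ (Valued.v x * exp (-((d : ℤ) - 1))) ^ 2 := pow_le_pow_left' h 2
    _ = Valued.v x ^ 2 * exp (-(2 * ((d : ℤ) - 1))) := by rw [mul_pow, ← exp_nsmul]; congr 2; ring

/-- **`|Tr_ρ(κα)| = |κ|·|α − ρα|`** when `|κ + ρκ|·|α| ≤ 1 < |κ|·|α − ρα|`. [cite: Jacobowitz1962, §4] -/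
theorem v_trace_mul_alpha_eq' (hvρ : ∀ x, Valued.v (ρ x) = Valued.v x) (hα1 : Valued.v α ≤ 1)
    {κ : M} (hκρ : Valued.v (κ + ρ κ) ≤ 1) (hκ1 : 1 < Valued.v κ * Valued.v (α - ρ α)) :
    Valued.v (κ * α + ρ (κ * α)) = Valued.v κ * Valued.v (α - ρ α) := by
  have e : κ * α + ρ (κ * α) = -(ρ κ * (α - ρ α)) + (κ + ρ κ) * α := by rw [map_mul]; ring
  have hbig : Valued.v (-(ρ κ * (α - ρ α))) = Valued.v κ * Valued.v (α - ρ α) := by rw [Valuation.map_neg, map_mul, hvρ]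
  have hsmall : Valued.v ((κ + ρ κ) * α) < Valued.v (-(ρ κ * (α - ρ α))) := by
    rw [hbig, map_mul]; exact lt_of_le_of_lt (mul_le_one' hκρ hα1) hκ1
  rw [e, Valuation.map_add_eq_of_lt_left _ hsmall, hbig]

/-- **`Tr_ρ(κ·𝒪_j)` IS INTEGRAL** when `|κ + ρκ| ≤ 1` and `|κ|·|cc|·|α − ρα| ≤ 1` (`|cc|, |α| ≤ 1`): `κζ + ρ(κζ) = A·Tr_ρ κ + B·Tr_ρ(κα)` with
`|Tr_ρ(κα)| ≤ max(|α|, |κ|·|α − ρα|)`. [cite: Jacobowitz1962, §4] -/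
theorem v_trace_mul_le_one_of_isOrd' (hρρ : ∀ x, ρ (ρ x) = x) (hvρ : ∀ x, Valued.v (ρ x) = Valued.v x) (hα : ρ α ≠ α) (hα1 : Valued.v α ≤ 1)
    {cc : M} (hcc : Valued.v cc ≤ 1) {κ : M} (hκρ : Valued.v (κ + ρ κ) ≤ 1) (hκcc : Valued.v κ * Valued.v cc * Valued.v (α - ρ α) ≤ 1)
    {ζ : M} (hζ : IsOrd ρ α cc ζ) : Valued.v (κ * ζ + ρ (κ * ζ)) ≤ 1 := by
  obtain ⟨hB, hA⟩ := coords_fixed hρρ hα ζ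
  obtain ⟨hB1, hA1⟩ := v_coords_le hα hα1 hcc hζ
  set B : M := (ζ - ρ ζ) / (α - ρ α)
  set A : M := ζ - B * α
  have hζAB : ζ = A + B * α := by simp [A]
  have e : κ * ζ + ρ (κ * ζ) = A * (κ + ρ κ) + B * (-(ρ κ * (α - ρ α)) + (κ + ρ κ) * α) := by
    rw [hζAB, map_mul, map_add, map_mul, hA, hB]; ring
  rw [e]
  refine (Valuation.map_add _ _ _).trans (max_le ?_ ?_)
  · rw [map_mul]; exact mul_le_one' hA1 hκρ
  · rw [map_mul]
    refine (mul_le_mul' hB1 (Valuation.map_add _ _ _)).trans ?_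
    rw [Valuation.map_neg, map_mul, map_mul, hvρ]
    rcases le_total (Valued.v κ * Valued.v (α - ρ α)) (Valued.v (κ + ρ κ) * Valued.v α) with h | h
    · rw [max_eq_right h]; exact mul_le_one' hcc (mul_le_one' hκρ hα1)
    · rw [max_eq_left h]
      calc Valued.v cc * (Valued.v κ * Valued.v (α - ρ α)) = Valued.v κ * Valued.v cc * Valued.v (α - ρ α) := by
            simp only [mul_comm, mul_left_comm]
        _ ≤ 1 := hκcc

/-- **THE LEVEL AND LOWER TOKENS WITH SKEW PARITY (lane C).**  `cc = jE ϖ^j` (`|jE ϖ| = exp(−2)`), `|α − ρα| = exp(−dρ)` via the relative datum `(ρ, ϖM, dρ)`; `w` with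
`|w| ≤ exp(−2k′)`, `ℓ + 1 ≤ k′`.  If `w∕jE ϖ^ℓ ∈ 𝒪_j` and `w∕jE ϖ^{ℓ+1} ∉ 𝒪_j`, then `|w − ρw| = exp(−(2ℓ + 2j + dρ))` EXACTLY (the window `(exp(−(2ℓ+2+2j+dρ)), exp(−(2ℓ+2j+dρ))]`
meets the skew values `exp(2n − dρ)` once) and `k′ ≤ j + ℓ` (skew gain of `ρ`: `|w − ρw| ≤ |w|·|ϖM|^{dρ−1}`). [cite: Serre1979, Ch. III §6 Prop. 12–13] [cite: Kottwitz1986BaseChangeUnits, §1 pp. 240–241] -/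
theorem v_sub_map_eq_of_tokens {ϖ : E} (hϖ : Valued.v ϖ = exp (-1 : ℤ)) (jE : E →+* M) (hjsq : ∀ a, Valued.v (jE a) = Valued.v a ^ 2)
    (hjfix : ∀ z, ρ z = z ↔ ∃ c, jE c = z) (hDρ : IsRamifiedQuadraticDatum ρ ϖM dρ tρ) (hαρ : α - ρ α = ϖM - ρ ϖM)
    {w : M} {j ℓ k' : ℕ} (hw : Valued.v w ≤ exp (-(2 * (k' : ℤ)))) (hℓk : ℓ + 1 ≤ k')
    (hlev : IsOrd ρ α (jE ϖ ^ j) (w / jE ϖ ^ ℓ)) (hn : ¬ IsOrd ρ α (jE ϖ ^ j) (w / jE ϖ ^ (ℓ + 1))) :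
    Valued.v (w - ρ w) = exp (-(2 * (ℓ : ℤ) + 2 * j + dρ)) ∧ k' ≤ j + ℓ := by
  have hDρ' := hDρ
  obtain ⟨hρ2, hvρ, hϖM, hfixρ, hdρ, h1dρ, -⟩ := hDρ
  have hvαρ : Valued.v (α - ρ α) = exp (-(dρ : ℤ)) := by rw [hαρ, hdρ, v_varpi_pow hϖM]
  have hρϖ : ∀ n : ℕ, ρ (jE ϖ ^ n) = jE ϖ ^ n := fun n => by rw [map_pow, (hjfix _).2 ⟨ϖ, rfl⟩]
  have hpow := v_map_varpi_pow_sq hϖ jE hjsq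
  have hne : ∀ n : ℕ, Valued.v (jE ϖ ^ n) ≠ 0 := fun n => by rw [hpow]; exact exp_ne_zero
  -- the level token: `|w − ρw| ≤ exp(−(2ℓ + 2j + dρ))`
  have hup : Valued.v (w - ρ w) ≤ exp (-(2 * (ℓ : ℤ) + 2 * j + dρ)) := by
    have h2 := ((isOrd_iff _ _ _ _).1 hlev).2
    rw [map_div₀, hρϖ, ← sub_div, map_div₀, div_le_iff₀ (zero_lt_iff.2 (hne ℓ)), map_mul, hvαρ, hpow, hpow, ← exp_add, ← exp_add] at h2
    convert h2 using 2; ring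
  -- the lower token: the `α`-clause fails
  have hlow : exp (-(2 * (ℓ : ℤ) + 2 + 2 * j + dρ)) < Valued.v (w - ρ w) := by
    rw [isOrd_iff, not_and_or] at hn
    have hfirst : Valued.v (w / jE ϖ ^ (ℓ + 1)) ≤ 1 := by
      rw [map_div₀, div_le_iff₀ (zero_lt_iff.2 (hne _)), one_mul, hpow]
      refine hw.trans ?_
      rw [exp_le_exp]; push_cast; omega
    rcases hn with hn | hn
    · exact absurd hfirst hn
    · rw [map_div₀, hρϖ, ← sub_div, map_div₀, div_le_iff₀ (zero_lt_iff.2 (hne _)), map_mul, hvαρ, hpow, hpow, ← exp_add, ← exp_add, not_le] at hn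
      convert hn using 2; push_cast; ring
  -- skew parity pins the value
  have hskew : ρ (w - ρ w) = -(w - ρ w) := by rw [map_sub, hρ2]; ring
  have hs0 : w - ρ w ≠ 0 := fun h0 => by rw [h0, map_zero] at hlow; exact not_lt.2 zero_le hlow
  obtain ⟨n, hn⟩ := exists_v_eq_exp_of_map_eq_neg hρ2 hfixρ hϖM hdρ hskew hs0
  have heq : Valued.v (w - ρ w) = exp (-(2 * (ℓ : ℤ) + 2 * j + dρ)) := by
    rw [hn] at hup hlow ⊢
    rw [exp_le_exp] at hup; rw [exp_lt_exp] at hlow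
    congr 1; omega
  refine ⟨heq, ?_⟩
  -- skew gain of `ρ`: `|w − ρw| ≤ |w|·exp(−(dρ − 1))`
  have hgain := v_sub_map_le_mul_of_datum hDρ' w
  rw [heq, v_varpi_pow hϖM] at hgain
  have := hgain.trans (mul_le_mul' hw le_rfl)
  rw [← exp_add, exp_le_exp] at this
  have : ((dρ - 1 : ℕ) : ℤ) = (dρ : ℤ) - 1 := by omega
  omega

end Summit.HodgeConjecture.HodgeConjecture.Cruxes.H413.F0P3cDyRamAxisLetterToolkitRamM

end
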